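import Literature.AlgebraicGeometry.HodgeTheory.WeilClassesSplitSquare
import Literature.AlgebraicGeometry.HodgeTheory.WeilClassesIsogenyDescent
import HarnessLib

/-!
# Tensor points are algebraic points: the Weil plane of every `(Y, Ψ)` `K`-isogenous to a split square is algebraic

Family `hodge`, layer `Literature/AlgebraicGeometry/HodgeTheory`. b2b cell `hweil` (carver, generation 5;
packet LADDER `## CARVER v5` C33). NO named fact, NO definition. Companion of `WeilClassesSplitSquare`
(Deligne's `A₀ ⊗ K = (T × T, Φ_d)`, `Φ_d = prodLift (snd ≫ (-(d • 𝟙))) fst`, whose Weil plane is algebraic for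
EVERY `T`, LNM 900 Lemma 4.5 / Remark 4.10, in the kernel) and of `WeilClassesIsogenyDescent` (van Geemen 3.7:
algebraicity of Weil classes passes along a `K`-equivariant isogeny pair):

* `weilClassesOf_le_algebraicClasses_of_isogenyPair` — the FULL-PLANE isogeny transfer: `f : A ⟶ B` flat,
  `g : B ⟶ A` with `g ≫ φ = ψ ≫ g`, `f ≫ g = m • 𝟙 A`, `m ≥ 1`, and `weilClassesOf B ψ n d ≤ Nⁿ(B)` give
  `weilClassesOf A φ n d ≤ Nⁿ(A)` (the tree's `mem_algebraicClasses_of_isogeny_of_mem_weilClassesOf` without the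
  rationality / Hodge-type bookkeeping, which the whole plane does not need);
* `weilClassesOf_le_algebraicClasses_of_tensorPoint` — for `k, p ≥ 1`, every abelian `2k`-fold `(Y, Ψ)` admitting
  a `K`-equivariant isogeny pair towards `(A₁ × A₁, Ψ₀)`, `dim A₁ = k`,
  `Ψ₀ = prodLift (snd ≫ (-((p : ℤ) • 𝟙))) fst` (the TENSOR POINTS of the predicate
  `HasLocallyAlgebraicTensorAnchors k p` of `WeilClassesLocalTensorAnchor`, written there with the `ℤ`-scalar;
  `natCast_zsmul` bridges to the `ℕ`-scalar of `WeilClassesSplitSquare`) has its WHOLE Weil plane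
  `weilClassesOf Y Ψ k p` algebraic — UNCONDITIONALLY;
* `mem_algebraicClasses_of_tensorPoint` — element form over the predicate's `∃`-clause verbatim.

Consequence (Summit side, `Theorems/WeilTypeLadderSquareGerm.lean`): the local tensor clause of door T is a
variational-Hodge GERM (the class at `s₀` is already algebraic).

## References
* [Deligne1982HodgeCycles] P. Deligne, Hodge cycles on abelian varieties, LNM 900 (1982), §4 Lemma 4.5,
  Remark 4.10, proof of Thm. 4.8 (b).
* [vanGeemen1994HodgeAV] B. van Geemen, LNM 1594 (1994), 3.6–3.7, proof of Lemma 5.2.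
* [Markman2025SurveySecant] E. Markman, survey (2025, unrefereed), §11.5 Step 1.
* [Milne1986AbelianVarieties] J. S. Milne, Abelian varieties (1986), §8 Prop. 8.1.
-/

noncomputable section

open CategoryTheory AlgebraicGeometry

namespace Literature.AlgebraicGeometry.HodgeTheory

open Literature.AlgebraicTopology.SingularHomology
open Literature.AlgebraicGeometry.Motives

section HodgeTheory

/-- **The algebraicity of the WHOLE Weil plane is a `K`-isogeny invariant**: given `f : A ⟶ B` flat,
`g : B ⟶ A` with `g ≫ φ = ψ ≫ g`, `f ≫ g = m • 𝟙 A`, `m ≥ 1`, if `weilClassesOf B ψ n d` consists of algebraic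
classes then so does `weilClassesOf A φ n d`: `g^*` maps the plane of `(A, φ)` into the plane of `(B, ψ)`
(`map_mem_weilClassesOf_of_comm`), flat `f^*` preserves algebraicity, and `f^* g^* c = m^{2n} • c`.
[cite: vanGeemen1994HodgeAV, 3.6–3.7] [cite: Markman2025SurveySecant, §11.5 Step 1]
[cite: Milne1986AbelianVarieties, §8 Prop. 8.1] -/
theorem weilClassesOf_le_algebraicClasses_of_isogenyPair {A B : Motives.AbelianVariety ℂ} {n d : ℕ}
    {φ : A ⟶ A} {ψ : B ⟶ B}
    (hA : Motives.IsSmoothProjective (2 * n) A.X) (hB : Motives.IsSmoothProjective (2 * n) B.X)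
    (f : A ⟶ B) (g : B ⟶ A) [Flat f.hom.hom.hom.left]
    (hg : g ≫ φ = ψ ≫ g) {m : ℕ} (hm : 0 < m) (hfg : f ≫ g = m • 𝟙 A)
    (halg : weilClassesOf B ψ n d ≤ algebraicClasses B.X n) :
    weilClassesOf A φ n d ≤ algebraicClasses A.X n := by
  intro c hcW
  have hc'W := map_mem_weilClassesOf_of_comm (n := n) (d := d) hg hcW
  have halg' := halg hc'W
  haveI : IsLocallyNoetherian A.X.left := Motives.IsSmoothProjective.isLocallyNoetherian_holds hA
  haveI : IsLocallyNoetherian B.X.left := Motives.IsSmoothProjective.isLocallyNoetherian_holds hB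
  have hfc' := map_mem_algebraicClasses_of_flat f.hom.hom.hom halg'
  -- `f^* g^* c = (f ≫ g)^* c = (m • 𝟙 A)^* c = m^{2n} • c`
  have key : complexBetti.map f.hom.hom.hom (2 * n)
      (singularCohomology.map ℂ ℂ (Motives.AlgPoints.mapContinuous (L := ℂ) g.hom.hom.hom) (2 * n) c) =
        ((m : ℂ) ^ (2 * n)) • c := by
    change singularCohomology.map ℂ ℂ (Motives.AlgPoints.mapContinuous (L := ℂ) f.hom.hom.hom) (2 * n)
      (singularCohomology.map ℂ ℂ (Motives.AlgPoints.mapContinuous (L := ℂ) g.hom.hom.hom) (2 * n) c) = _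
    rw [abelianVarietyHom_map_map_apply, hfg, map_nsmul_id_eq_of_mem_weilClassesOf m hcW]
  rw [key] at hfc'
  have hmC : ((m : ℂ) ^ (2 * n)) ≠ 0 := pow_ne_zero _ (Nat.cast_ne_zero.mpr hm.ne')
  have h := Submodule.smul_mem (algebraicClasses A.X n) (((m : ℂ) ^ (2 * n))⁻¹) hfc'
  rwa [smul_smul, inv_mul_cancel₀ hmC, one_smul] at h

/-- **At every tensor point the whole Weil plane is algebraic — unconditionally** (`k ≥ 1`, `p ≥ 1`): `(Y, Ψ)`
carries a `K`-equivariant isogeny pair towards the split square `(A₁ × A₁, Ψ₀)`,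
`Ψ₀ = prodLift (snd ≫ (-((p : ℤ) • 𝟙))) fst` (= Deligne's `A₁ ⊗ K`; `natCast_zsmul` to the `ℕ`-scalar form of
`WeilClassesSplitSquare`), whose Weil plane is algebraic by `weilClassesOf_splitSquare_le_algebraicClasses`
(Deligne, LNM 900 Lemma 4.5 / Remark 4.10, in the kernel); transfer by
`weilClassesOf_le_algebraicClasses_of_isogenyPair`.
[cite: Deligne1982HodgeCycles, §4 Lemma 4.5, Remark 4.10, proof of Thm. 4.8 (b)] [cite: vanGeemen1994HodgeAV, 3.7] -/
theorem weilClassesOf_le_algebraicClasses_of_tensorPoint {k p : ℕ} (hk : 0 < k) (hp : 0 < p)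
    {Y : Motives.AbelianVariety ℂ} {Ψ : Y ⟶ Y} (hY : Y.dim = 2 * k)
    {A₁ : Motives.AbelianVariety ℂ} (f₁ : Y ⟶ A₁.prod A₁) (g₁ : A₁.prod A₁ ⟶ Y) {m : ℕ}
    (hA₁ : A₁.dim = k) (hm : 0 < m) (hfg : f₁ ≫ g₁ = m • 𝟙 Y) (hflat : Flat f₁.hom.hom.hom.left)
    (hg : g₁ ≫ Ψ = Motives.AbelianVariety.prodLift
      (Motives.AbelianVariety.snd A₁ A₁ ≫ (-((p : ℤ) • 𝟙 A₁))) (Motives.AbelianVariety.fst A₁ A₁) ≫ g₁) :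
    weilClassesOf Y Ψ k p ≤ algebraicClasses Y.X k := by
  haveI := hflat
  have hΦ : Motives.AbelianVariety.prodLift (Motives.AbelianVariety.snd A₁ A₁ ≫ (-((p : ℤ) • 𝟙 A₁)))
        (Motives.AbelianVariety.fst A₁ A₁) =
      Motives.AbelianVariety.prodLift (Motives.AbelianVariety.snd A₁ A₁ ≫ (-(p • 𝟙 A₁)))
        (Motives.AbelianVariety.fst A₁ A₁) := by
    rw [natCast_zsmul]
  rw [hΦ] at hg
  exact weilClassesOf_le_algebraicClasses_of_isogenyPair (Motives.isSmoothProjective_of_dim_eq' hY)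
    (Motives.isSmoothProjective_of_dim_eq' (dim_twistedSquare hA₁)) f₁ g₁ hg hm hfg
    (weilClassesOf_splitSquare_le_algebraicClasses hk hA₁ hp)

/-- **Element form over the tensor clause of `HasLocallyAlgebraicTensorAnchors k p` (its `∃`-hypothesis
VERBATIM)**: every class of the Weil plane of a tensor point is algebraic — in particular the class `x` of the
local tensor clause, BEFORE any local hypothesis is invoked. [cite: Deligne1982HodgeCycles, §4 Remark 4.10] -/
theorem mem_algebraicClasses_of_tensorPoint {k p : ℕ} (hk : 0 < k) (hp : 0 < p)
    {Y : Motives.AbelianVariety ℂ} {Ψ : Y ⟶ Y} (hY : Y.dim = 2 * k)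
    (hpt : ∃ (A₁ : Motives.AbelianVariety ℂ) (f₁ : Y ⟶ A₁.prod A₁) (g₁ : A₁.prod A₁ ⟶ Y) (m : ℕ),
      A₁.dim = k ∧ 0 < m ∧ f₁ ≫ g₁ = m • 𝟙 Y ∧ Flat f₁.hom.hom.hom.left ∧
      g₁ ≫ Ψ = Motives.AbelianVariety.prodLift
        (Motives.AbelianVariety.snd A₁ A₁ ≫ (-((p : ℤ) • 𝟙 A₁))) (Motives.AbelianVariety.fst A₁ A₁) ≫ g₁)
    {x : complexBetti Y.X (2 * k)} (hx : x ∈ weilClassesOf Y Ψ k p) :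
    x ∈ algebraicClasses Y.X k := by
  obtain ⟨A₁, f₁, g₁, m, hA₁, hm, hfg, hflat, hg⟩ := hpt
  exact weilClassesOf_le_algebraicClasses_of_tensorPoint hk hp hY f₁ g₁ hA₁ hm hfg hflat hg hx

end HodgeTheory

end Literature.AlgebraicGeometry.HodgeTheory

end
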